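import Summits.ValiantsHypothesis.ValiantsHypothesis.Theorems.KPlusLogSqLawTropicalPermutationChanges

/-!
# Route «KPlusLogSqLaw», crux `TropicalB` (stmt-ValiantsHypothesis-19771) — the `K = 4` FORK is a question about PERMUTATION TURNOVER:
# `TropK4Law e` (`e ≥ 2`) ⟺ an `O((m+1)^e)` budget on permutation-changing steps; a LINEAR budget on distinct permutations already gives `TropK4Law 2`

HONEST FRAMING.  Helper toward the registered stubs of `Cruxes/TropicalB/Lines/birth.lean` (crux
`Summit.ValiantsHypothesis.ValiantsHypothesis.Theses.KPlusLogSqLaw.TropicalB`, item stmt-ValiantsHypothesis-19771, route KPlusLogSqLaw; hand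
leafhand-val-kpluslogsqlaw-1 g18, 2026-09-01; `--supports … --as helper`).  BOOKKEEPING over the tree's turnover laws (val-sym-lift-p2,
`…TropicalPermutationChanges`: `le_permChanges_add` — `n ≤ P + m²(K−1)`, `P` = permutation-CHANGING steps; `succ_le_card_perms_mul` —
`n + 1 ≤ F·(m(K−1)+1)`, `F` = DISTINCT permutations) at the fixed class count `K = 4`, where the cell's desk docket D2 («the `K = 4` fork»:
`TropK4Law 2`, i.e. `T(m,4) = O(m²)`, versus a cubic column `¬ TropK4Law 2`; `…CensusTropicalKLaw`, `…TropicalBExponentFork.tropK4Law_fork`)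
is OPEN.  Nothing here decides the fork, and nothing bears on `TropicalB` in its window, `WeakLifting`, `Lifting`, `MatrixDescartes`
(stmt-ValiantsHypothesis-18050) or VP ≠ VNP.

* `K4ForkPermBudget.tropK4Law_iff_permSteps` — for `2 ≤ e`: `TropK4Law e ↔ ∃ C, every sign-alternating dominant chain of every `(m,4)` design
  changes its permutation at most `C·(m+1)^e` times` (class flips are `≤ 3m² ≤ 3(m+1)^e` in total);
* `K4ForkPermBudget.cardPerms_of_tropK4Law` — `TropK4Law e ⇒` every such chain uses at most `(C+1)·(m+1)^e` distinct permutations;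
* `K4ForkPermBudget.tropK4Law_succ_of_cardPerms` — conversely a budget `C·(m+1)^e` on DISTINCT permutations gives `TropK4Law (e+1)` (each
  permutation carries `≤ 3m + 1` chain terms); in particular (`tropK4Law_two_of_linear_cardPerms`) **a LINEAR budget on distinct permutations
  implies `TropK4Law 2`** — so a cubic `K = 4` column requires families whose chains use super-linearly many distinct optimal assignments
  (the kernel's counting-tight `(5,4)` chain uses 37 distinct permutations on 5 rows; the cell's hand-built families use `O(m)`).

[folklore: bookkeeping over the two cited tree laws; `TropK4Law` is the cell's definition, no citation exists]
-/

set_option linter.dupNamespace false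
set_option autoImplicit false

namespace Summit.ValiantsHypothesis.ValiantsHypothesis.Theorems.KPlusLogSqLaw

namespace K4ForkPermBudget

open Summit.ValiantsHypothesis.ValiantsHypothesis.Theorems.LacunarySymmetroidMatrixDescartes.TropicalCensus
open Summit.ValiantsHypothesis.ValiantsHypothesis.Theorems.MatrixDescartes.Negative
open Finset

/-! ## 1. Permutation-changing steps -/

/-- **Permutation-step budget ⇒ `TropK4Law e`** (`2 ≤ e`, constant `C + 3`): the remaining steps are class switches at a fixed permutation,
at most `m·m·3 ≤ 3(m+1)^e` of them (`le_permChanges_add`). [folklore: bookkeeping] -/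
theorem tropK4Law_of_permSteps {e : ℕ} (he : 2 ≤ e)
    (h : ∃ C : ℕ, ∀ (m : ℕ) (d : Fin 4 → ℕ) (v ε : Fin m → Fin m → Fin 4 → ℤ) (n : ℕ) (θ : Fin (n + 1) → ℤ)
      (p : Fin (n + 1) → Equiv.Perm (Fin m) × (Fin m → Fin 4)),
      (∀ i j l, (ε i j l).natAbs ≤ 1) → StrictMono θ → (∀ k, IsDominant d v ε (θ k) (p k)) →
      (∀ k : Fin n, termSign ε (p k.castSucc) * termSign ε (p k.succ) < 0) →
      (univ.filter fun k : Fin n => (p k.castSucc).1 ≠ (p k.succ).1).card ≤ C * (m + 1) ^ e) :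
    TropK4Law e := by
  classical
  obtain ⟨C, hC⟩ := h
  refine ⟨C + 3, fun m => ?_⟩
  intro d v ε n θ p hε hθ hdom halt
  have h1 := le_permChanges_add d v ε n θ p hθ hdom halt
  have h2 := hC m d v ε n θ p hε hθ hdom halt
  have h3 : m * m ≤ (m + 1) ^ e := by
    calc m * m ≤ (m + 1) * (m + 1) := Nat.mul_le_mul (Nat.le_succ m) (Nat.le_succ m)
      _ = (m + 1) ^ 2 := by ring
      _ ≤ (m + 1) ^ e := Nat.pow_le_pow_right (Nat.succ_pos m) he
  have h4 : m * m * (4 - 1) ≤ 3 * (m + 1) ^ e := by omega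
  have h5 : (C + 3) * (m + 1) ^ e = C * (m + 1) ^ e + 3 * (m + 1) ^ e := by ring
  omega

/-- **`TropK4Law e` ⇒ permutation-step budget** (same constant): permutation-changing steps are a subset of all steps. [folklore] -/
theorem permSteps_of_tropK4Law {e : ℕ} (h : TropK4Law e) :
    ∃ C : ℕ, ∀ (m : ℕ) (d : Fin 4 → ℕ) (v ε : Fin m → Fin m → Fin 4 → ℤ) (n : ℕ) (θ : Fin (n + 1) → ℤ)
      (p : Fin (n + 1) → Equiv.Perm (Fin m) × (Fin m → Fin 4)),
      (∀ i j l, (ε i j l).natAbs ≤ 1) → StrictMono θ → (∀ k, IsDominant d v ε (θ k) (p k)) →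
      (∀ k : Fin n, termSign ε (p k.castSucc) * termSign ε (p k.succ) < 0) →
      (univ.filter fun k : Fin n => (p k.castSucc).1 ≠ (p k.succ).1).card ≤ C * (m + 1) ^ e := by
  classical
  obtain ⟨C, hC⟩ := h
  refine ⟨C, fun m d v ε n θ p hε hθ hdom halt => ?_⟩
  have h1 : n ≤ C * (m + 1) ^ e := hC m d v ε n θ p hε hθ hdom halt
  calc (univ.filter fun k : Fin n => (p k.castSucc).1 ≠ (p k.succ).1).card ≤ (univ : Finset (Fin n)).card :=
        card_filter_le _ _
    _ = n := by rw [card_univ, Fintype.card_fin]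
    _ ≤ C * (m + 1) ^ e := h1

/-- **The `K = 4` exponent law is a permutation-step budget** (`2 ≤ e`): `TropK4Law e` holds iff, for some `C`, every sign-alternating dominant
chain of every `(m, 4)` dominance design changes its PERMUTATION at most `C·(m+1)^e` times.  In particular the fork `TropK4Law 2` asks exactly
whether permutation turnover at four slope classes is `O(m²)`. [folklore: bookkeeping] -/
theorem tropK4Law_iff_permSteps {e : ℕ} (he : 2 ≤ e) :
    TropK4Law e ↔ ∃ C : ℕ, ∀ (m : ℕ) (d : Fin 4 → ℕ) (v ε : Fin m → Fin m → Fin 4 → ℤ) (n : ℕ) (θ : Fin (n + 1) → ℤ)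
      (p : Fin (n + 1) → Equiv.Perm (Fin m) × (Fin m → Fin 4)),
      (∀ i j l, (ε i j l).natAbs ≤ 1) → StrictMono θ → (∀ k, IsDominant d v ε (θ k) (p k)) →
      (∀ k : Fin n, termSign ε (p k.castSucc) * termSign ε (p k.succ) < 0) →
      (univ.filter fun k : Fin n => (p k.castSucc).1 ≠ (p k.succ).1).card ≤ C * (m + 1) ^ e :=
  ⟨permSteps_of_tropK4Law, tropK4Law_of_permSteps he⟩

/-! ## 2. Distinct permutations -/

/-- **`TropK4Law e` ⇒ distinct-permutation budget** (constant `C + 1`): a chain of `n + 1` terms uses at most `n + 1 ≤ C(m+1)^e + (m+1)^e`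
permutations. [folklore: bookkeeping] -/
theorem cardPerms_of_tropK4Law {e : ℕ} (h : TropK4Law e) :
    ∃ C : ℕ, ∀ (m : ℕ) (d : Fin 4 → ℕ) (v ε : Fin m → Fin m → Fin 4 → ℤ) (n : ℕ) (θ : Fin (n + 1) → ℤ)
      (p : Fin (n + 1) → Equiv.Perm (Fin m) × (Fin m → Fin 4)),
      (∀ i j l, (ε i j l).natAbs ≤ 1) → StrictMono θ → (∀ k, IsDominant d v ε (θ k) (p k)) →
      (∀ k : Fin n, termSign ε (p k.castSucc) * termSign ε (p k.succ) < 0) →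
      (univ.image fun k => (p k).1).card ≤ C * (m + 1) ^ e := by
  classical
  obtain ⟨C, hC⟩ := h
  refine ⟨C + 1, fun m d v ε n θ p hε hθ hdom halt => ?_⟩
  have h1 : n ≤ C * (m + 1) ^ e := hC m d v ε n θ p hε hθ hdom halt
  have h2 : 1 ≤ (m + 1) ^ e := Nat.one_le_pow _ _ (Nat.succ_pos m)
  calc (univ.image fun k => (p k).1).card ≤ (univ : Finset (Fin (n + 1))).card := card_image_le
    _ = n + 1 := by rw [card_univ, Fintype.card_fin]
    _ ≤ C * (m + 1) ^ e + (m + 1) ^ e := Nat.add_le_add h1 h2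
    _ = (C + 1) * (m + 1) ^ e := by ring

/-- **Distinct-permutation budget of order `e` ⇒ `TropK4Law (e+1)`** (constant `3C`): each permutation carries at most `3m + 1 ≤ 3(m+1)` chain
terms (`succ_le_card_perms_mul` at `K = 4`). [folklore: bookkeeping] -/
theorem tropK4Law_succ_of_cardPerms {e : ℕ}
    (h : ∃ C : ℕ, ∀ (m : ℕ) (d : Fin 4 → ℕ) (v ε : Fin m → Fin m → Fin 4 → ℤ) (n : ℕ) (θ : Fin (n + 1) → ℤ)
      (p : Fin (n + 1) → Equiv.Perm (Fin m) × (Fin m → Fin 4)),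
      (∀ i j l, (ε i j l).natAbs ≤ 1) → StrictMono θ → (∀ k, IsDominant d v ε (θ k) (p k)) →
      (∀ k : Fin n, termSign ε (p k.castSucc) * termSign ε (p k.succ) < 0) →
      (univ.image fun k => (p k).1).card ≤ C * (m + 1) ^ e) :
    TropK4Law (e + 1) := by
  classical
  obtain ⟨C, hC⟩ := h
  refine ⟨3 * C, fun m => ?_⟩
  intro d v ε n θ p hε hθ hdom halt
  have h1 := succ_le_card_perms_mul d v ε n θ p hθ hdom halt
  have h2 := hC m d v ε n θ p hε hθ hdom halt
  have h3 : m * (4 - 1) + 1 ≤ 3 * (m + 1) := by omega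
  have h4 : n + 1 ≤ C * (m + 1) ^ e * (3 * (m + 1)) := h1.trans (Nat.mul_le_mul h2 h3)
  have h5 : C * (m + 1) ^ e * (3 * (m + 1)) = 3 * C * (m + 1) ^ (e + 1) := by ring
  rw [h5] at h4
  omega

/-- **A LINEAR budget on distinct permutations implies `TropK4Law 2`.**  If every sign-alternating dominant chain of every `(m,4)` design uses
at most `C·(m+1)` distinct permutations, then `T(m,4) ≤ 3C·(m+1)²` — so a cubic `K = 4` column needs chains with super-linearly many distinct
optimal assignments. [folklore: bookkeeping] -/
theorem tropK4Law_two_of_linear_cardPerms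
    (h : ∃ C : ℕ, ∀ (m : ℕ) (d : Fin 4 → ℕ) (v ε : Fin m → Fin m → Fin 4 → ℤ) (n : ℕ) (θ : Fin (n + 1) → ℤ)
      (p : Fin (n + 1) → Equiv.Perm (Fin m) × (Fin m → Fin 4)),
      (∀ i j l, (ε i j l).natAbs ≤ 1) → StrictMono θ → (∀ k, IsDominant d v ε (θ k) (p k)) →
      (∀ k : Fin n, termSign ε (p k.castSucc) * termSign ε (p k.succ) < 0) →
      (univ.image fun k => (p k).1).card ≤ C * (m + 1)) :
    TropK4Law 2 := by
  obtain ⟨C, hC⟩ := h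
  refine tropK4Law_succ_of_cardPerms (e := 1) ⟨C, fun m d v ε n θ p hε hθ hdom halt => ?_⟩
  rw [pow_one]
  exact hC m d v ε n θ p hε hθ hdom halt

end K4ForkPermBudget

end Summit.ValiantsHypothesis.ValiantsHypothesis.Theorems.KPlusLogSqLaw
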